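import Summits.ValiantsHypothesis.ValiantsHypothesis.Theorems.BarrierLeverChowThinRowsMonomialBasis

/-!
# Route BarrierLever — item `ChowHitsThinRowPartitionMinorsR` (stmt-ValiantsHypothesis-21850, budget
# `h·h`): the standard monomial basis is GRADED — re-interpolation never raises the degree

Helper file (`--supports stmt-ValiantsHypothesis-21850`; cell valiant-natproofs, rung V4, 𝒟-side;
seat val-np-p5 gen 28).  Closes NO item; definition-free; imports only val-np-p7 g4's
`…ChowThinRowsMonomialBasis`.

`exists_downClosed_monomialBasis_graded`: for injective columns `w` there is an injective down-closed
`U : Fin r → Finset (Fin h)` with `det [U i ⊆ w j] ≠ 0` (val-np-p7's standard sets) such that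
(i) `{c}` is among the `U i` for every coordinate `c` whose indicator is not in the span of the all-ones
vector and the indicators of the coordinates `c' < c` (as in `…RBasisSingletons`), and
(ii) **GRADING**: for EVERY `T ⊆ Fin h` the monomial vector `j ↦ [T ⊆ w j]` is a combination of the
basis vectors `j ↦ [U i ⊆ w j]` with `|U i| ≤ |T|` only.
(ii) is ingredient (G1) of the proof plan for Conjecture AC′ (memo MEMO-21850-hh-valnp5-g28 §7.3/§10):
the `s`-expansion of the scaled leave-out matrix `Ê(s)` factors as `(Σ_m s^m K_m) · Z_Δ` with `K_m`
raising the degree by at most `m`, because every re-interpolation of a non-basis monomial stays in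
degree `≤` its own.  It is `ChowThinAll.monomialVec_mem_span_std` (smaller key ⇒ not larger size)
transported through the packaging of `exists_downClosed_monomialBasis`.

WHAT THIS IS NOT: item 21850 is NOT proved; nothing on items 21882 / 19717, on crux
stmt-ValiantsHypothesis-14610, or on `VP` versus `VNP`.
-/

set_option linter.dupNamespace false

namespace Summit.ValiantsHypothesis.ValiantsHypothesis.Theorems.BarrierLever.ChowThinHH

open Finset
open Summit.ValiantsHypothesis.ValiantsHypothesis.Theorems.BarrierLever.ChowThinAll
  (card_std std_linearIndependent nonStd_mono monomialVec_mem_span_std card_le_of_key_lt key_injective)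

variable {h r : ℕ}

open Classical in
/-- **Graded down-closed monomial basis.**  See the module docstring. -/
theorem exists_downClosed_monomialBasis_graded (w : Fin r → Finset (Fin h))
    (hw : Function.Injective w) :
    ∃ U : Fin r → Finset (Fin h), Function.Injective U ∧
      (∀ i (S : Finset (Fin h)), S ⊆ U i → ∃ i', U i' = S) ∧
      (Matrix.of fun i j : Fin r => if U i ⊆ w j then (1 : ℂ) else 0).det ≠ 0 ∧
      (∀ c : Fin h, (fun j : Fin r => if c ∈ w j then (1 : ℂ) else 0) ∉ Submodule.span ℂ
          (insert (fun _ : Fin r => (1 : ℂ))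
            ((fun c' : Fin h => fun j : Fin r => if c' ∈ w j then (1 : ℂ) else 0) '' {c' | c' < c})) →
        ∃ i, U i = {c}) ∧
      (∀ T : Finset (Fin h), (fun j : Fin r => if T ⊆ w j then (1 : ℂ) else 0) ∈ Submodule.span ℂ
          ((fun i : Fin r => fun j : Fin r => if U i ⊆ w j then (1 : ℂ) else 0) '' {i | (U i).card ≤ T.card})) := by
  set ι := {T : Finset (Fin h) //
        (fun j : Fin r => if T ⊆ w j then (1 : ℂ) else 0) ∉ Submodule.span ℂ
          ((fun S' : Finset (Fin h) => fun j : Fin r => if S' ⊆ w j then (1 : ℂ) else 0) ''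
            {T' | T'.card * 2 ^ h + ∑ c ∈ T', 2 ^ (c : ℕ) < T.card * 2 ^ h + ∑ c ∈ T, 2 ^ (c : ℕ)})}
  have hcard : Fintype.card ι = r := card_std w hw
  let e : Fin r ≃ ι := (Fintype.equivFinOfCardEq hcard).symm
  refine ⟨fun i => (e i).1, Subtype.val_injective.comp e.injective, ?_, ?_, ?_, ?_⟩
  · intro i S hS
    have hstd : (fun j : Fin r => if S ⊆ w j then (1 : ℂ) else 0) ∉ Submodule.span ℂ
        ((fun S' : Finset (Fin h) => fun j : Fin r => if S' ⊆ w j then (1 : ℂ) else 0) ''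
          {T' | T'.card * 2 ^ h + ∑ c ∈ T', 2 ^ (c : ℕ) < S.card * 2 ^ h + ∑ c ∈ S, 2 ^ (c : ℕ)}) :=
      fun hN => (e i).2 (nonStd_mono w hN hS)
    refine ⟨e.symm ⟨S, hstd⟩, ?_⟩
    simp
  · have hli : LinearIndependent ℂ (fun i : Fin r => fun j : Fin r => if (e i).1 ⊆ w j then (1 : ℂ) else 0) :=
      (std_linearIndependent w).comp e e.injective
    have hrows : LinearIndependent ℂ
        (Matrix.of fun i j : Fin r => if (e i).1 ⊆ w j then (1 : ℂ) else 0).row := by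
      have e2 : (Matrix.of fun i j : Fin r => if (e i).1 ⊆ w j then (1 : ℂ) else 0).row =
          fun i : Fin r => fun j : Fin r => if (e i).1 ⊆ w j then (1 : ℂ) else 0 := by
        funext i j
        rfl
      rw [e2]
      exact hli
    have hU := Matrix.linearIndependent_rows_iff_isUnit.mp hrows
    exact ((Matrix.isUnit_iff_isUnit_det _).mp hU).ne_zero
  · intro c hc
    have hstd : (fun j : Fin r => if ({c} : Finset (Fin h)) ⊆ w j then (1 : ℂ) else 0) ∉ Submodule.span ℂ
        ((fun S' : Finset (Fin h) => fun j : Fin r => if S' ⊆ w j then (1 : ℂ) else 0) ''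
          {T' | T'.card * 2 ^ h + ∑ c' ∈ T', 2 ^ (c' : ℕ) <
            ({c} : Finset (Fin h)).card * 2 ^ h + ∑ c' ∈ ({c} : Finset (Fin h)), 2 ^ (c' : ℕ)}) := by
      intro hmem
      apply hc
      have e1 : (fun j : Fin r => if ({c} : Finset (Fin h)) ⊆ w j then (1 : ℂ) else 0) =
          fun j : Fin r => if c ∈ w j then (1 : ℂ) else 0 := by
        funext j
        simp only [Finset.singleton_subset_iff]
      rw [e1] at hmem
      refine Submodule.span_mono ?_ hmem
      rintro _ ⟨T', hT', rfl⟩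
      -- key(T') < key({c}) ⇒ T' = ∅ or a singleton {c'} with c' < c
      have hT'' : T'.card * 2 ^ h + ∑ c' ∈ T', 2 ^ (c' : ℕ) <
          ({c} : Finset (Fin h)).card * 2 ^ h + ∑ c' ∈ ({c} : Finset (Fin h)), 2 ^ (c' : ℕ) := hT'
      rw [Finset.card_singleton, Finset.sum_singleton, one_mul] at hT''
      have hc2 : 2 ^ (c : ℕ) < 2 ^ h := Nat.pow_lt_pow_right (by norm_num) c.2
      have hcard : T'.card ≤ 1 := by
        by_contra hlt
        have h2 : 2 * 2 ^ h ≤ T'.card * 2 ^ h := Nat.mul_le_mul_right _ (by omega)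
        have := Finset.sum_nonneg (f := fun c' : Fin h => 2 ^ (c' : ℕ)) (s := T') (fun _ _ => Nat.zero_le _)
        omega
      rcases Nat.lt_or_ge T'.card 1 with h0 | h1
      · have hT0 : T' = ∅ := Finset.card_eq_zero.mp (by omega)
        subst hT0
        refine Set.mem_insert_iff.mpr (Or.inl ?_)
        funext j
        simp
      · obtain ⟨c', rfl⟩ := Finset.card_eq_one.mp (le_antisymm hcard h1)
        rw [Finset.card_singleton, Finset.sum_singleton, one_mul] at hT''
        have hlt : 2 ^ (c' : ℕ) < 2 ^ (c : ℕ) := by omega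
        have hc'c : c' < c := Fin.lt_def.mpr ((Nat.pow_lt_pow_iff_right (by norm_num)).mp hlt)
        refine Set.mem_insert_of_mem _ ⟨c', hc'c, ?_⟩
        funext j
        simp only [Finset.singleton_subset_iff]
    refine ⟨e.symm ⟨{c}, hstd⟩, ?_⟩
    simp
  · -- grading: standard sets of key ≤ key(T) have size ≤ |T|
    intro T
    refine Submodule.span_mono ?_ (monomialVec_mem_span_std w T)
    rintro _ ⟨T', ⟨hstd, hkey⟩, rfl⟩
    refine ⟨e.symm ⟨T', hstd⟩, ?_, ?_⟩
    · show ((e (e.symm ⟨T', hstd⟩)).1).card ≤ T.card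
      rw [Equiv.apply_symm_apply]
      show T'.card ≤ T.card
      rcases hkey.lt_or_eq with hlt | heq
      · exact card_le_of_key_lt hlt
      · rw [key_injective heq]
    · funext j
      simp

end Summit.ValiantsHypothesis.ValiantsHypothesis.Theorems.BarrierLever.ChowThinHH
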